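import Summits.Parity.GeneralizedHardyLittlewood.Theorems.PrimeLevelFamEdgeMomentsBeyondDiagonalDiagRemThreeThreeKernels
import HarnessLib

/-!
# Route `PrimeLevelFamEdge`, crux K_A `MomentsBeyondDiagonal` (stmt-Parity-20007), line «petersson_layers» v4, stub `stub_diag`:
# **the remainder kernels `r_ab`, `a ≤ i`, `b ≤ j`, of the GENERIC order `(i,j)` under ONE constant** (brick (R4) of the generic
# remainder estimate (R_ij) of the census `Cruxes/MomentsBeyondDiagonal/Lines/petersson_layers_stub_diag_g19_generic_assembly.md`)

The remainder part `rem_ij` of `…DiagGenericAssembly.selbergOrder_split i j` carries the `(i+1)(j+1)` continued Bose remainders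
`r_ab(y) = c_ab(y) − (E_ab + Σ_{i′,j′} C(a,i′)C(b,j′)((−1)^{j′}+(−1)^{i′})μ_{i′+j′}(−1/2)^N log(1/y)^{N+1}/(N+1))`, `N = a−i′+(b−j′)`,
with the LEVEL-FREE constants `E_ab = c_ab(1) + ∫_{(0,1]}(η·(…) − ∫…)/η` and `μ_m = ∫_{(0,1]} logᵐv·v/(1+v²)²` — literally the
`Π`-form of the generic kernel lemma `…DiagRemThreeThreeKernels.abs_bose_rem_twoSeq_small_tail a b` (no choice of constants needed).
The per-order files bundled the kernels by hand (`…DiagRemFourFourKernelsAll.twoSeq_twentyfive₄₄`, 25 named kernels); here, for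
EVERY `(i,j)`, all `r_ab` with `a ≤ i`, `b ≤ j` are put under one constant `C₀ = Σ_{a≤i,b≤j} C₀(a,b)`, with the common two-sequence
envelope `9C₀(1+|log 2αY²|)^{i+j+2}` and the common large-argument exponent `i+j+1`:

* `twoSeq_weaken_gen` — the envelope `3(C′+C′xᵐ)+2C′+C′xᵐ·x` of the generic kernel lemma is below `9C·x^N` for `C′ ≤ C`, `m+1 ≤ N`, `x ≥ 1`;
* `twoSeq_kernels_gen i j` — **∃ `C₀ ≥ 0`, ∀ `a ≤ i`, `b ≤ j`: the two-sequence Abel estimate for `r_ab` (envelope exponent `i+j+2`)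
  ∧ `|r_ab(y)| ≤ C₀√y` (`0 < y ≤ 1`) ∧ `|r_ab(y)| ≤ C₀(1+log y)^{i+j+1}` (`y ≥ 1`)** — the kernel input of the generic inner estimate.

Def-free; theorems only. Helper `--supports stmt-Parity-20007`; closes nothing; K_A, K_B and the Parity summit are NOT proved;
nothing about Landau–Siegel zeros.

## References
* E. Kowalski, P. Michel, J. VanderKam, J. reine angew. Math. 526 (2000), (22)–(28) pp. 12–15 and Prop. 5.1 p. 18.
  [cite: KowalskiMichelVanderKam2000, (23)–(28) and Prop. 5.1 — derivation (remainder kernels of the diagonal, every order)]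
-/

noncomputable section

open Real MeasureTheory Finset

namespace Summit.Parity.GeneralizedHardyLittlewood.Theorems.MomentsBeyondDiagonal.DiagCorner

open Summit.Parity.GeneralizedHardyLittlewood.Theorems.BeyondDiagonalBeatsQuarter.Corner

/-- The two-sequence envelope of the generic kernel lemma, `3(C′ + C′xᵐ) + 2C′ + C′xᵐ·x`, is below the common envelope `9C·x^N`
(`0 ≤ C′ ≤ C`, `m + 1 ≤ N`, `x ≥ 1`); the first term is monotone in the constant. [folklore] -/
theorem twoSeq_weaken_gen {S₁ S₂ B η Li Lj s x C' C v : ℝ} {m N : ℕ} (hS₁ : 0 ≤ S₁) (hS₂ : 0 ≤ S₂) (hB : 0 ≤ B)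
    (hη : 0 ≤ η) (hLi : 0 ≤ Li) (hLj : 0 ≤ Lj) (hs : 0 ≤ s) (hx : 1 ≤ x) (hC'0 : 0 ≤ C') (hC : C' ≤ C) (hmN : m + 1 ≤ N)
    (hv : v ≤ S₁ * (B * (Lj * (3 * C' * s))) +
      S₂ * ((2 * η) * (Li * (3 * (C' + C' * x ^ m) + 2 * C' + C' * x ^ m * x)))) :
    v ≤ S₁ * (B * (Lj * (3 * C * s))) + S₂ * ((2 * η) * (Li * (9 * C * x ^ N))) := by
  have hx0 : 0 ≤ x := zero_le_one.trans hx
  have hxN : 1 ≤ x ^ N := one_le_pow₀ hx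
  have hxmN : x ^ m ≤ x ^ N := pow_le_pow_right₀ hx (by omega)
  have hxm1N : x ^ m * x ≤ x ^ N := by rw [← pow_succ]; exact pow_le_pow_right₀ hx hmN
  have hC0 : 0 ≤ C := hC'0.trans hC
  have e1 : 3 * C' * s ≤ 3 * C * s := by nlinarith
  have e2 : 3 * (C' + C' * x ^ m) + 2 * C' + C' * x ^ m * x ≤ 9 * C * x ^ N := by
    nlinarith [mul_le_mul hC hxN (by norm_num) hC0, mul_le_mul hC hxmN (pow_nonneg hx0 m) hC0,
      mul_le_mul hC hxm1N (by positivity) hC0]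
  refine hv.trans (add_le_add ?_ ?_)
  · exact mul_le_mul_of_nonneg_left (mul_le_mul_of_nonneg_left (mul_le_mul_of_nonneg_left e1 hLj) hB) hS₁
  · exact mul_le_mul_of_nonneg_left (mul_le_mul_of_nonneg_left (mul_le_mul_of_nonneg_left e2 hLi)
      (by positivity)) hS₂

set_option maxHeartbeats 1600000 in
/-- **The remainder kernels `r_ab`, `a ≤ i`, `b ≤ j`, of the generic order `(i,j)` under ONE constant** (module docstring):
two-sequence Abel estimate with the common envelope `9C₀(1+|log 2αY²|)^{i+j+2}`, and the pointwise bounds `|r_ab(y)| ≤ C₀√y`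
(`0 < y ≤ 1`), `|r_ab(y)| ≤ C₀(1+log y)^{i+j+1}` (`y ≥ 1`), the kernels in the `Π`-form of `abs_bose_rem_twoSeq_small_tail` with the
explicit level-free constants `E_ab`, `μ_m`.
[cite: KowalskiMichelVanderKam2000, (23)–(28) and Prop. 5.1 — derivation (remainder kernels of the diagonal, every order)] -/
theorem twoSeq_kernels_gen (i j : ℕ) : ∃ C₀ : ℝ, 0 ≤ C₀ ∧ ∀ a b : ℕ, a ≤ i → b ≤ j →
    (∀ (a₁ a₂ : ℕ → ℝ) (Y α B η : ℝ) (K₁ m₁ m₂ : ℕ), 1 ≤ Y → 0 < α → 1 ≤ m₁ → 1 ≤ m₂ →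
      (∀ e : ℕ, e ≤ ⌊Y⌋₊ → |∑ k ∈ Icc 1 e, a₂ k| ≤ B) → (∀ e : ℕ, K₁ ≤ e → |∑ k ∈ Icc 1 e, a₁ k| ≤ η) →
      2 * α * K₁ * Y ≤ 1 →
    |∑ k₁ ∈ Icc 1 ⌊Y⌋₊, ∑ k₂ ∈ Icc 1 ⌊Y⌋₊,
        a₁ k₁ * a₂ k₂ * ellp Y k₁ ^ m₁ * ellp Y k₂ ^ m₂ * ((∫ u₁ in Set.Ioi (0 : ℝ), Real.log u₁ ^ a * ∫ u₂ in Set.Ioi ((α * k₁ * k₂) / u₁), Real.exp (-(u₁ + u₂)) / (1 - Real.exp (-(u₁ + u₂))) ^ 2 * Real.log u₂ ^ b) - (((∫ u₁ in Set.Ioi (0 : ℝ), Real.log u₁ ^ a * ∫ u₂ in Set.Ioi (1 / u₁), Real.exp (-(u₁ + u₂)) / (1 - Real.exp (-(u₁ + u₂))) ^ 2 * Real.log u₂ ^ b) + (∫ η in Set.Ioc (0 : ℝ) 1, (η * (∫ u in Set.Ioi (0 : ℝ), Real.log u ^ a * Real.log (η / u) ^ b * (Real.exp (-(u + η / u)) /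 (1 - Real.exp (-(u + η / u))) ^ 2) / u) - ∫ v in Set.Ioc (0 : ℝ) 1, ((-(Real.log (1 / η) / 2) + Real.log v) ^ a * (-(Real.log (1 / η) / 2) - Real.log v) ^ b + (-(Real.log (1 / η) / 2) - Real.log v) ^ a * (-(Real.log (1 / η) / 2) + Real.log v) ^ b) * (v / (1 + v ^ 2) ^ 2)) / η)) + ∑ i' ∈ Finset.range (a + 1), ∑ j' ∈ Finset.range (b + 1), ((a).choose i' : ℝ) * ((b).choose j' : ℝ) * ((-1) ^ j' + (-1) ^ i') * (∫ v in Set.Ioc (0 : ℝ) 1, Real.log v ^ (i' + j') * (v / (1 + v ^ 2) ^ 2)) * ((-1 / 2 : ℝ) ^ (a - i' + (b - j')) * Real.log (1 / (α * k₁ * k₂)) ^ (a - i' + (b - j') + 1) / (((a - i' + (b - j') : ℕ) : ℝ) + 1))))| ≤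
      (∑ k ∈ Icc 1 ⌊Y⌋₊, |a₁ k| * ellp Y k ^ m₁) * (B * (Real.log Y ^ m₂ * (3 * C₀ * Real.sqrt (2 * α * K₁ * Y)))) +
        (∑ k ∈ Icc 1 ⌊Y⌋₊, |a₂ k| * ellp Y k ^ m₂) *
          ((2 * η) * (Real.log Y ^ m₁ * (9 * C₀ * (1 + |Real.log (2 * α * Y ^ 2)|) ^ (i + j + 2))))) ∧
    (∀ y : ℝ, 0 < y → y ≤ 1 →
      |((∫ u₁ in Set.Ioi (0 : ℝ), Real.log u₁ ^ a * ∫ u₂ in Set.Ioi (y / u₁), Real.exp (-(u₁ + u₂)) / (1 - Real.exp (-(u₁ + u₂))) ^ 2 * Real.log u₂ ^ b) - (((∫ u₁ in Set.Ioi (0 : ℝ), Real.log u₁ ^ a * ∫ u₂ in Set.Ioi (1 / u₁), Real.exp (-(u₁ + u₂)) / (1 - Real.exp (-(u₁ + u₂))) ^ 2 * Real.log u₂ ^ b) + (∫ η in Set.Ioc (0 : ℝ) 1, (η * (∫ u in Set.Ioi (0 : ℝ), Real.log u ^ a * Real.log (η / u) ^ b * (Real.exp (-(u + η / u)) / (1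 - Real.exp (-(u + η / u))) ^ 2) / u) - ∫ v in Set.Ioc (0 : ℝ) 1, ((-(Real.log (1 / η) / 2) + Real.log v) ^ a * (-(Real.log (1 / η) / 2) - Real.log v) ^ b + (-(Real.log (1 / η) / 2) - Real.log v) ^ a * (-(Real.log (1 / η) / 2) + Real.log v) ^ b) * (v / (1 + v ^ 2) ^ 2)) / η)) + ∑ i' ∈ Finset.range (a + 1), ∑ j' ∈ Finset.range (b + 1), ((a).choose i' : ℝ) * ((b).choose j' : ℝ) * ((-1) ^ j' + (-1) ^ i') * (∫ v in Set.Ioc (0 : ℝ) 1, Real.log v ^ (i' + j') * (v / (1 + v ^ 2) ^ 2)) * ((-1 / 2 : ℝ) ^ (a - i' + (b - j')) * Real.log (1 / y) ^ (a - i' + (b - j') + 1) / (((a - i' + (b - j') : ℕ) : ℝ) + 1))))| ≤ C₀ * Real.sqrt y) ∧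
    (∀ y : ℝ, 1 ≤ y →
      |((∫ u₁ in Set.Ioi (0 : ℝ), Real.log u₁ ^ a * ∫ u₂ in Set.Ioi (y / u₁), Real.exp (-(u₁ + u₂)) / (1 - Real.exp (-(u₁ + u₂))) ^ 2 * Real.log u₂ ^ b) - (((∫ u₁ in Set.Ioi (0 : ℝ), Real.log u₁ ^ a * ∫ u₂ in Set.Ioi (1 / u₁), Real.exp (-(u₁ + u₂)) / (1 - Real.exp (-(u₁ + u₂))) ^ 2 * Real.log u₂ ^ b) + (∫ η in Set.Ioc (0 : ℝ) 1, (η * (∫ u in Set.Ioi (0 : ℝ), Real.log u ^ a * Real.log (η / u) ^ b * (Real.exp (-(u + η / u)) / (1 - Real.exp (-(u + η / u))) ^ 2) / u) - ∫ v in Set.Ioc (0 : ℝ) 1, ((-(Real.log (1 / η) / 2) + Real.log v) ^ a * (-(Real.log (1 / η) / 2) - Real.log v) ^ b + (-(Real.log (1 / η) / 2) - Real.log v) ^ a * (-(Real.log (1 / η) / 2) + Real.log v) ^ b) * (v / (1 + v ^ 2) ^ 2)) / η)) + ∑ i' ∈ Finset.range (a + 1), ∑ j' ∈ Finset.range (b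 + 1), ((a).choose i' : ℝ) * ((b).choose j' : ℝ) * ((-1) ^ j' + (-1) ^ i') * (∫ v in Set.Ioc (0 : ℝ) 1, Real.log v ^ (i' + j') * (v / (1 + v ^ 2) ^ 2)) * ((-1 / 2 : ℝ) ^ (a - i' + (b - j')) * Real.log (1 / y) ^ (a - i' + (b - j') + 1) / (((a - i' + (b - j') : ℕ) : ℝ) + 1))))| ≤ C₀ * (1 + Real.log y) ^ (i + j + 1)) := by
  classical
  choose C hC0 hC using fun p : ℕ × ℕ ↦ abs_bose_rem_twoSeq_small_tail p.1 p.2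
  refine ⟨∑ p ∈ Finset.range (i + 1) ×ˢ Finset.range (j + 1), C p, Finset.sum_nonneg fun p _ ↦ hC0 p,
    fun a b ha hb ↦ ?_⟩
  set C₀ : ℝ := ∑ p ∈ Finset.range (i + 1) ×ˢ Finset.range (j + 1), C p with hC₀
  have hmem : (a, b) ∈ Finset.range (i + 1) ×ˢ Finset.range (j + 1) := by
    rw [Finset.mem_product, Finset.mem_range, Finset.mem_range]; omega
  have hle : C (a, b) ≤ C₀ := Finset.single_le_sum (fun p _ ↦ hC0 p) hmem
  have hCab : 0 ≤ C (a, b) := hC0 (a, b)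
  have hC₀0 : 0 ≤ C₀ := hCab.trans hle
  obtain ⟨h2, hs, ht⟩ := hC (a, b)
  dsimp only at h2 hs ht
  refine ⟨fun a₁ a₂ Y α B η K₁ m₁ m₂ hY hα hm₁ hm₂ hB hη hY₁ ↦ ?_, fun y hy hy1 ↦ ?_, fun y hy ↦ ?_⟩
  · have hLY0 : 0 ≤ Real.log Y := Real.log_nonneg hY
    have hB0 : 0 ≤ B := (abs_nonneg _).trans (hB 0 (Nat.zero_le _))
    have hη0 : 0 ≤ η := (abs_nonneg _).trans (hη K₁ le_rfl)
    have hS₁ : 0 ≤ ∑ k ∈ Icc 1 ⌊Y⌋₊, |a₁ k| * ellp Y k ^ m₁ :=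
      Finset.sum_nonneg fun k _ ↦ mul_nonneg (abs_nonneg _) (pow_nonneg (ellp_nonneg Y k) m₁)
    have hS₂ : 0 ≤ ∑ k ∈ Icc 1 ⌊Y⌋₊, |a₂ k| * ellp Y k ^ m₂ :=
      Finset.sum_nonneg fun k _ ↦ mul_nonneg (abs_nonneg _) (pow_nonneg (ellp_nonneg Y k) m₂)
    have hx1 : 1 ≤ 1 + |Real.log (2 * α * Y ^ 2)| := by linarith [abs_nonneg (Real.log (2 * α * Y ^ 2))]
    exact twoSeq_weaken_gen hS₁ hS₂ hB0 hη0 (pow_nonneg hLY0 m₁) (pow_nonneg hLY0 m₂) (Real.sqrt_nonneg _) hx1 hCab hle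
      (by omega) (h2 a₁ a₂ Y α B η K₁ m₁ m₂ hY hα hm₁ hm₂ hB hη hY₁)
  · exact (hs y hy hy1).trans (mul_le_mul_of_nonneg_right hle (Real.sqrt_nonneg y))
  · have hl1 : 1 ≤ 1 + Real.log y := by linarith [Real.log_nonneg hy]
    calc _ ≤ C (a, b) * (1 + Real.log y) ^ (a + b + 1) := ht y hy
      _ ≤ C₀ * (1 + Real.log y) ^ (i + j + 1) :=
          mul_le_mul hle (pow_le_pow_right₀ hl1 (by omega)) (by positivity) hC₀0

end Summit.Parity.GeneralizedHardyLittlewood.Theorems.MomentsBeyondDiagonal.DiagCorner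

end
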